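import Literature.MathematicalPhysics.QuantumFieldTheory.Balaban1983to89.Beta.RemainderLimitTorus

/-!
# [Balaban1987RG1] (1.7)/(1.21): termwise locality of the polarization terms FROM the printed locality of the
activities — the term factors through the restricted configuration (`Beta.RemainderLocality`)

HONEST FRAMING (cell rule, page 1 of everything).  Discharging `BetaPertH` makes Bałaban's UV stability UNCONDITIONAL —
a real constructive-QFT result; it is NOT the continuum limit and NOT the Clay problem.  This module discharges NOTHING
of `BetaPertH`; it RE-TYPES the one located clause left by `Beta.RemainderLimitTorus` (the termwise-locality field
`PolLeavesTLoc.hloc`: for a fixed localization domain Y ⊂ ℤ^d the polarization TERM of its reduction Y mod N_n at the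
sites 0, z mod N_nM converges as the torus grows) into two inputs of PRINTED SHAPE, and derives `hloc` from them in the
kernel.  Bookkeeping-grade; NOT summit progress.

ABSOLUTE RULE (cell).  "No internally-minted statement may enter as a cited fact. Every hypothesis is either
kernel-proved in this package or a verbatim quotation of a PUBLISHED theorem with page reference. The manuscript(s)
under audit are NOT citable for their own disputed steps — they are the thing under adjudication; programme-internal
(2001/route/tribunal) claims are never citable."  Every `def` below is a definition, a hypothesis STRUCTURE (whose
fields are displayed hypotheses, never facts), or a proved theorem.

## The two inputs ([I] = [Balaban1987RG1], CMP 109; renders checked for this module)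

(F1) LOCALITY OF THE ACTIVITIES, AS PRINTED.  [I] p. 261, after (1.7): *"Again, the term corresponding to a domain X
depends on U_j restricted to X."*; p. 263, before (1.18): *"It depends on the configurations restricted to X, i.e. on
(U, J)|_X. It is a C^∞-function of g_{j−1} ∈ [0, γ], (or analytic)"*; p. 264, after (1.21): *"This limit exists by the
localized representation (1.7)."*  TYPED: for every localization domain Y of ℤ^d there are an n-INDEPENDENT complex
normed space `V Y` (the configurations restricted to Y), an n-independent functional `F Y : V Y → ℂ` ANALYTIC at the
zero configuration, and continuous linear RESTRICTION maps `r n Y : W_n →L[ℂ] V Y` from the test-vector space of torus n,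
such that, for n large, the activity of the reduction X̄_n(Y) = Y mod N_n FACTORS through the restriction on the
α₂-ball: `𝐄_n(X̄_n(Y), v) = F Y (r n Y v)` (field `hfac`, eventually in n — the reduction is a faithful copy of Y only once
the torus is larger than Y, `RemainderLimitTorus.liftDom_tproj`).  Print's OWN indexing of the term functional by the
domains of the infinite lattice is [I] p. 290: *"We extend it to all X ∈ 𝐃⁰_j, where 𝐃⁰_j is the class of localization
domains constructed for the lattice ξZ⁴."* … *"This means that we sum the function 𝐄^{(2)}(X) over X ∈ 𝐃⁰_j, because
the other expressions do not depend on X."*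

(F2) CONVERGENCE OF THE RESTRICTED TEST CONFIGURATIONS.  The (4.35) test vectors `h_n(X̄, x)` of the torus leaf list
([I] (4.35) p. 290 with the decay of p. 282, field `hh`: the configurations generated by the unit external field at the
site x through the minimizers / the operators 𝐇 of the step — objects of the WHOLE torus) restricted to Y CONVERGE in
`V Y` as n → ∞: `r n Y (h_n(X̄_n(Y), x mod N_nM)) → t Y x` (field `hconv`).  Print's move at this point is [I] p. 290:
*"If we replace H_j(□₀) by H_j with free boundary conditions, then the difference H_j(□₀) − H_j restricted to
X × supp ζ̃_□, yields the factor B₀ exp(−δ₀M(L^jη)^{−1}) in a bound of the corresponding expression."* … *"Next, we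
extend summations over y to the whole lattice Z⁴."*  This is a volume-limit statement of the SAME
CLASS as the cell's entrywise volume limits of propagator / minimizer kernels (the wall's (ii-a)/(ii-a′) inputs;
[Balaban1984PropagatorsI] p. 36: *"relating G on the torus to G on the whole lattice ηZ^d in the usual way"*) — LOCATED
here as a hypothesis field, not discharged, and not a new kind of leaf.

## What is PROVED here (kernel-checked; [folklore] calculus on the tree's `B12Decay510.mixedDeriv`)

(K1) GERM INVARIANCE `mixedDeriv_congr_of_eqOn_ball`: ∂²E(a, b) := ∂_τ[DE(τb)a]∣₀ depends on E only through its values on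
a ball around 0.  (K2) CHAIN RULE THROUGH A CONTINUOUS LINEAR MAP `mixedDeriv_comp_clm`: ∂²(F ∘ r)(a, b) = ∂²F(ra, rb) for F
differentiable on a ball around 0.  (K3) THE SECOND FRÉCHET DERIVATIVE `mixedDeriv_eq_fderiv_fderiv`: ∂²F(a, b) =
D²F(0)[b][a] whenever DF is differentiable at 0 (e.g. F analytic at 0), whence JOINT CONTINUITY in (a, b)
(`continuous_mixedDeriv`, `tendsto_mixedDeriv`).  (K4) `PolLeavesTFac.hloc_of_fac`: (F1) + (F2) + the torus leaf list's
(4.35) representation `hrepr` ⟹ `hloc` with the IDENTIFIED limit terms `a Y z = Re ∂²(F Y)(t Y 0, t Y z)` — so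
`PolLeavesTFac ⟹ PolLeavesTLoc` (`toPolLeavesTLoc`) ⟹ the (5.1) limit, the (5.10) decay and the k-uniform remainder bound
with the SAME fully valued coefficient: `ChainTFac.abs_beta1_le : … → RemainderConst S γ (c.ε₁ · remCoeffL d M c α₂ B₃)`
LITERALLY, plus the RULING (R10) consumers by name.

## What is NOT claimed

* No leaf of the (β) class is discharged: the [II] Lemma-3 / (2.13) / p. 15 leaves, the [I] (4.4)/(4.35)/p. 282 leaves,
  and now (F1) (the printed locality, typed as factorization through restriction) and (F2) (an (ii-a′)-class volume
  limit of the restricted test configurations) are HYPOTHESIS FIELDS of `PolLeavesTFac`.  The module's content is that the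
  bespoke clause `hloc` of `RemainderLimitTorus` is IMPLIED by inputs print states ((F1)) or the cell already carries as a
  class ((F2)); the identification `a Y z = Re ∂²(F Y)(t Y 0, t Y z)` is then the DEFINITION of the infinite-volume term.
* No `Literature` fact is minted; no `axiom`, no `sorry`.
-/

namespace Literature.MathematicalPhysics.QuantumFieldTheory.Balaban1983to89.Beta.RemainderLocality

open Literature.MathematicalPhysics.QuantumFieldTheory.Balaban1983to89
open FlowStep DagBinding FlowStepRuns
open Literature.MathematicalPhysics.QuantumFieldTheory.Balaban1983to89.B13ScaleTransfer (Pt)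
open Literature.MathematicalPhysics.QuantumFieldTheory.Balaban1983to89.B13Resummation (SpRestr Repr213)
open Literature.MathematicalPhysics.QuantumFieldTheory.Balaban1983to89.TreeLengthTorus (TPt TDom proj)
open Literature.MathematicalPhysics.QuantumFieldTheory.Balaban1983to89.TreeLengthTorusGeometry (TorusStep)
open Literature.MathematicalPhysics.QuantumFieldTheory.Balaban1983to89.B12Decay510 (mixedDeriv)
open Literature.MathematicalPhysics.QuantumFieldTheory.Balaban1983to89.B12Decay510Torus (distCT nearT)
open Literature.MathematicalPhysics.QuantumFieldTheory.Balaban1983to89.Beta.RemainderChain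
open Literature.MathematicalPhysics.QuantumFieldTheory.Balaban1983to89.Beta.RemainderChainLattice
  (CondsL SignsL remCoeffL)
open Literature.MathematicalPhysics.QuantumFieldTheory.Balaban1983to89.Beta.RemainderLimitTorus
  (LDom tproj limKernel PolLeavesTLoc ChainTLoc betaPartialSumsLowerH_of_telescope_chainTLoc
    endpointExistence_of_telescope_chainTLoc)
open Metric Filter Topology

noncomputable section

/-! ## 1. Calculus of the (4.3) mixed derivative `B12Decay510.mixedDeriv` -/

section Calculus

variable {W V : Type*} [NormedAddCommGroup W] [NormedSpace ℂ W] [NormedAddCommGroup V] [NormedSpace ℂ V]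

/-- **(K1) Germ invariance**: the mixed derivative ∂_τ[DE(τb)a]∣_{τ=0} of (4.3) depends on E only through its values on a
ball around 0 (two functions agreeing on the open ball ‖v‖ < ρ have the same Fréchet derivative at each of its points,
and τb lies in it for τ near 0). [folklore] -/
theorem mixedDeriv_congr_of_eqOn_ball {E₁ E₂ : W → ℂ} {ρ : ℝ} (hρ : 0 < ρ) (h : Set.EqOn E₁ E₂ (ball 0 ρ))
    (a b : W) : mixedDeriv E₁ a b = mixedDeriv E₂ a b := by
  unfold mixedDeriv
  apply Filter.EventuallyEq.deriv_eq
  have hopen : IsOpen {τ : ℂ | τ • b ∈ ball (0 : W) ρ} :=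
    isOpen_ball.preimage (continuous_id.smul continuous_const)
  have h0 : (0 : ℂ) ∈ {τ : ℂ | τ • b ∈ ball (0 : W) ρ} := by simp [hρ]
  filter_upwards [hopen.mem_nhds h0] with τ hτ
  exact congrArg (fun L : W →L[ℂ] ℂ => L a) ((h.eventuallyEq_of_mem (isOpen_ball.mem_nhds hτ)).fderiv_eq)

/-- **(K2) Chain rule through a continuous linear map**: for F differentiable on a ball around 0 of `V` and a continuous
linear `r : W →L[ℂ] V`, ∂²(F ∘ r)(a, b) = ∂²F(ra, rb) (`fderiv (F ∘ r) (τb) = DF(τ·rb) ∘ r` for τ near 0). [folklore] -/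
theorem mixedDeriv_comp_clm {F : V → ℂ} {ρ : ℝ} (hρ : 0 < ρ) (hF : ∀ y ∈ ball (0 : V) ρ, DifferentiableAt ℂ F y)
    (r : W →L[ℂ] V) (a b : W) : mixedDeriv (fun w => F (r w)) a b = mixedDeriv F (r a) (r b) := by
  unfold mixedDeriv
  apply Filter.EventuallyEq.deriv_eq
  have hopen : IsOpen {τ : ℂ | τ • r b ∈ ball (0 : V) ρ} :=
    isOpen_ball.preimage (continuous_id.smul continuous_const)
  have h0 : (0 : ℂ) ∈ {τ : ℂ | τ • r b ∈ ball (0 : V) ρ} := by simp [hρ]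
  filter_upwards [hopen.mem_nhds h0] with τ hτ
  have hτ' : r (τ • b) ∈ ball (0 : V) ρ := by simpa [map_smul] using hτ
  have hcomp : fderiv ℂ (fun w => F (r w)) (τ • b) = (fderiv ℂ F (r (τ • b))).comp r := by
    rw [show (fun w => F (r w)) = F ∘ r from rfl, fderiv_comp (τ • b) (hF _ hτ') r.differentiableAt,
      ContinuousLinearMap.fderiv]
  rw [hcomp, ContinuousLinearMap.comp_apply, map_smul]

/-- **(K3) The mixed derivative IS the second Fréchet derivative**: ∂²F(a, b) = D²F(0)[b][a] whenever the Fréchet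
derivative DF is differentiable at 0. [folklore] -/
theorem mixedDeriv_eq_fderiv_fderiv {F : V → ℂ} (hF : DifferentiableAt ℂ (fderiv ℂ F) 0) (a b : V) :
    mixedDeriv F a b = fderiv ℂ (fderiv ℂ F) 0 b a := by
  unfold mixedDeriv
  have hφ : HasDerivAt (fun τ : ℂ => τ • b) b 0 := by
    simpa using (hasDerivAt_id (0 : ℂ)).smul_const b
  have hG : HasDerivAt (fun τ : ℂ => fderiv ℂ F (τ • b)) (fderiv ℂ (fderiv ℂ F) 0 b) 0 :=
    HasFDerivAt.comp_hasDerivAt_of_eq (hl := hF.hasFDerivAt) (hf := hφ) (hy := by simp)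
  have hA : HasDerivAt (fun τ : ℂ => (fderiv ℂ F (τ • b)) a) ((fderiv ℂ (fderiv ℂ F) 0 b) a) 0 := by
    simpa using hG.clm_apply (hasDerivAt_const (0 : ℂ) a)
  exact hA.deriv

/-- For F ANALYTIC at 0 the Fréchet derivative is differentiable at 0 (it is analytic there). [folklore] -/
theorem differentiableAt_fderiv_of_analyticAt {F : V → ℂ} (hF : AnalyticAt ℂ F 0) :
    DifferentiableAt ℂ (fderiv ℂ F) 0 :=
  hF.fderiv.differentiableAt

/-- **(K3′) Joint continuity** of (a, b) ↦ ∂²F(a, b) = D²F(0)[b][a] (a continuous bilinear map). [folklore] -/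
theorem continuous_mixedDeriv {F : V → ℂ} (hF : DifferentiableAt ℂ (fderiv ℂ F) 0) :
    Continuous (fun q : V × V => mixedDeriv F q.1 q.2) := by
  have h : (fun q : V × V => mixedDeriv F q.1 q.2) = fun q => fderiv ℂ (fderiv ℂ F) 0 q.2 q.1 := by
    funext q; exact mixedDeriv_eq_fderiv_fderiv hF q.1 q.2
  rw [h]
  exact ((fderiv ℂ (fderiv ℂ F) 0).continuous.comp continuous_snd).clm_apply continuous_fst

/-- **(K3″) Limits pass through the mixed derivative**: a_i → a, b_i → b ⟹ ∂²F(a_i, b_i) → ∂²F(a, b). [folklore] -/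
theorem tendsto_mixedDeriv {F : V → ℂ} (hF : DifferentiableAt ℂ (fderiv ℂ F) 0) {ι : Type*} {l : Filter ι}
    {u v : ι → V} {a b : V} (hu : Tendsto u l (𝓝 a)) (hv : Tendsto v l (𝓝 b)) :
    Tendsto (fun i => mixedDeriv F (u i) (v i)) l (𝓝 (mixedDeriv F a b)) :=
  ((continuous_mixedDeriv hF).tendsto (a, b)).comp (hu.prodMk_nhds hv)

/-- Sanity of the API: the mixed derivative of a continuous LINEAR functional vanishes. [folklore] -/
example (φ : V →L[ℂ] ℂ) (a b : V) : mixedDeriv φ a b = 0 := by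
  unfold mixedDeriv
  simp [ContinuousLinearMap.fderiv]

end Calculus

variable {d : ℕ}

/-! ## 2. The torus leaf list with the printed LOCALITY (F1) and the restricted test-configuration limits (F2) -/

/-- **THE TORUS LEAF LIST WITH (1.7)-FACTORIZATION** — `RemainderLimitTorus.PolLeavesTLoc` verbatim EXCEPT its last field:
instead of `hloc` (termwise convergence) the PRINTED-SHAPE inputs (F1) — restricted-configuration spaces `V Y`, functionals
`F Y` analytic at 0, continuous linear restrictions `r n Y`, and the factorization `𝐄_n(X̄_n(Y), v) = F Y (r n Y v)` on
the α₂-ball for n large ([I] p. 261 *"the term corresponding to a domain X depends on U_j restricted to X"*, p. 263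
*"It depends on the configurations restricted to X, i.e. on (U, J)|_X"*) — and (F2) — the restricted (4.35) test
configurations converge, `r n Y (h_n(X̄_n(Y), x mod N_nM)) → t Y x` (a volume limit of the minimizer-generated
configurations, the class of the cell's (ii-a′) inputs) — together with the IDENTIFICATION `ha` of the infinite-volume
terms `a Y z = Re ∂²(F Y)(t Y 0, t Y z)`.  A HYPOTHESIS structure: nothing of it is discharged here.
[cite: Balaban1987RG1, (1.7) p.261, (1.18) p.263, (1.21) p.264, (4.35) p.290 and (5.1) p.292; Balaban1988RG2Cluster, (2.38) p.20 and (2.13) p.14] -/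
structure PolLeavesTFac (d M : ℕ) [NeZero M] (a : LDom d → Pt d → ℝ) (c : B13.Consts) (ℓ α₂ B₃ : ℝ) where
  N : ℕ → ℕ
  [hN : ∀ n, NeZero (N n)]
  hNlim : Tendsto N atTop atTop
  W : (n : ℕ) → TorusStep d (N n)
  hsp : ∀ n, SpRestr (W n).toStepData (W n).geom
  hrep : ∀ n, Repr213 (W n).toStepData (W n).geom
  h238 : ∀ n, B13.Bound238With (W n).toStepData c ℓ
  Wn : ℕ → Type
  [instW : ∀ n, NormedAddCommGroup (Wn n)]
  [instWs : ∀ n, NormedSpace ℂ (Wn n)]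
  EXn : (n : ℕ) → TDom d (N n) → Wn n → ℂ
  emb : (n : ℕ) → TDom d (N n) → Wn n → (W n).Φ
  hemb : ∀ n X, ∀ v ∈ ball (0 : Wn n) α₂, emb n X v ∈ (W n).sp2 X
  hcomp : ∀ n X v, EXn n X v = (W n).Ek1 X (emb n X v)
  hn : (n : ℕ) → TDom d (N n) → TPt d (N n * M) → Wn n
  E2n : (n : ℕ) → TDom d (N n) → TPt d (N n * M) → TPt d (N n * M) → ℝ
  han : ∀ n X, AnalyticOnNhd ℂ (EXn n X) (ball 0 α₂)
  hrepr : ∀ n X x y, E2n n X x y = (mixedDeriv (EXn n X) (hn n X x) (hn n X y)).re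
  hh : ∀ n X x, ‖hn n X x‖ ≤ B₃ * Real.exp (-c.δ₀ * distCT (N n) M x (nearT (M := M) x X))
  V : LDom d → Type
  [instV : ∀ Y, NormedAddCommGroup (V Y)]
  [instVs : ∀ Y, NormedSpace ℂ (V Y)]
  F : (Y : LDom d) → V Y → ℂ
  hF : ∀ Y, AnalyticAt ℂ (F Y) 0
  r : (n : ℕ) → (Y : LDom d) → Wn n →L[ℂ] V Y
  hfac : ∀ Y : LDom d, ∀ᶠ n in atTop, ∀ v ∈ ball (0 : Wn n) α₂, EXn n (tproj (N n) Y) v = F Y (r n Y v)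
  t : (Y : LDom d) → Pt d → V Y
  hconv : ∀ (Y : LDom d) (x : Pt d),
    Tendsto (fun n => r n Y (hn n (tproj (N n) Y) (proj (N n * M) x))) atTop (𝓝 (t Y x))
  ha : ∀ (Y : LDom d) (z : Pt d), a Y z = (mixedDeriv (F Y) (t Y 0) (t Y z)).re

/-- The carried `NeZero (N n)` witnesses, as instances keyed on the leaf list. [folklore] -/
instance PolLeavesTFac.instNeZeroN {d M : ℕ} [NeZero M] {a : LDom d → Pt d → ℝ} {c : B13.Consts} {ℓ α₂ B₃ : ℝ}
    (Lv : PolLeavesTFac d M a c ℓ α₂ B₃) (n : ℕ) : NeZero (Lv.N n) := Lv.hN n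

/-- The carried normed-group structures of the test-vector spaces. [folklore] -/
instance PolLeavesTFac.instNormedAddCommGroupWn {d M : ℕ} [NeZero M] {a : LDom d → Pt d → ℝ} {c : B13.Consts}
    {ℓ α₂ B₃ : ℝ} (Lv : PolLeavesTFac d M a c ℓ α₂ B₃) (n : ℕ) : NormedAddCommGroup (Lv.Wn n) := Lv.instW n

/-- The carried ℂ-normed-space structures of the test-vector spaces. [folklore] -/
instance PolLeavesTFac.instNormedSpaceWn {d M : ℕ} [NeZero M] {a : LDom d → Pt d → ℝ} {c : B13.Consts}
    {ℓ α₂ B₃ : ℝ} (Lv : PolLeavesTFac d M a c ℓ α₂ B₃) (n : ℕ) : NormedSpace ℂ (Lv.Wn n) := Lv.instWs n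

/-- The carried normed-group structures of the restricted-configuration spaces. [folklore] -/
instance PolLeavesTFac.instNormedAddCommGroupV {d M : ℕ} [NeZero M] {a : LDom d → Pt d → ℝ} {c : B13.Consts}
    {ℓ α₂ B₃ : ℝ} (Lv : PolLeavesTFac d M a c ℓ α₂ B₃) (Y : LDom d) : NormedAddCommGroup (Lv.V Y) := Lv.instV Y

/-- The carried ℂ-normed-space structures of the restricted-configuration spaces. [folklore] -/
instance PolLeavesTFac.instNormedSpaceV {d M : ℕ} [NeZero M] {a : LDom d → Pt d → ℝ} {c : B13.Consts}
    {ℓ α₂ B₃ : ℝ} (Lv : PolLeavesTFac d M a c ℓ α₂ B₃) (Y : LDom d) : NormedSpace ℂ (Lv.V Y) := Lv.instVs Y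

section Leaves

variable {M : ℕ} [NeZero M] {a : LDom d → Pt d → ℝ} {c : B13.Consts} {ℓ α₂ B₃ : ℝ}
  (Lv : PolLeavesTFac d M a c ℓ α₂ B₃)

/-- **The polarization term of the reduced domain, read through the restriction** (for n large): by (4.35) `hrepr`, germ
invariance (K1) with the factorization (F1) on the α₂-ball, and the chain rule (K2),
`𝐄^{(2)}_n(X̄_n(Y); 0, z) = Re ∂²(F Y)(r n Y h_n(X̄_n(Y), 0), r n Y h_n(X̄_n(Y), z mod N_nM))`. [cite: Balaban1987RG1, (1.7) p.261 and (4.35) p.290] -/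
theorem PolLeavesTFac.term_eq_eventually (hα₂ : 0 < α₂) (Y : LDom d) (z : Pt d) :
    ∀ᶠ n in atTop, Lv.E2n n (tproj (Lv.N n) Y) (proj (Lv.N n * M) 0) (proj (Lv.N n * M) z) =
      (mixedDeriv (Lv.F Y) (Lv.r n Y (Lv.hn n (tproj (Lv.N n) Y) (proj (Lv.N n * M) 0)))
        (Lv.r n Y (Lv.hn n (tproj (Lv.N n) Y) (proj (Lv.N n * M) z)))).re := by
  obtain ⟨ρ, hρ, hρF⟩ := Metric.eventually_nhds_iff_ball.mp (Lv.hF Y).eventually_analyticAt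
  have hFd : ∀ y ∈ ball (0 : Lv.V Y) ρ, DifferentiableAt ℂ (Lv.F Y) y := fun y hy => (hρF y hy).differentiableAt
  filter_upwards [Lv.hfac Y] with n hfac
  rw [Lv.hrepr, mixedDeriv_congr_of_eqOn_ball hα₂ (fun v hv => hfac v hv), mixedDeriv_comp_clm hρ hFd]

/-- **(K4) TERMWISE LOCALITY DERIVED**: (F1) + (F2) ⟹ the term of the reduction of Y at the sites 0, z mod N_nM converges
to `a Y z = Re ∂²(F Y)(t Y 0, t Y z)` (the term-level content of p. 264 *"This limit exists by the localized
representation (1.7)"*: the eventual identity `term_eq_eventually`, then (K3″) along the convergent restricted test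
configurations and continuity of the real part). [cite: Balaban1987RG1, (1.21) p.264 and (1.7) p.261] -/
theorem PolLeavesTFac.hloc_of_fac (hα₂ : 0 < α₂) (Y : LDom d) (z : Pt d) :
    Tendsto (fun n => Lv.E2n n (tproj (Lv.N n) Y) (proj (Lv.N n * M) 0) (proj (Lv.N n * M) z)) atTop
      (𝓝 (a Y z)) := by
  have hlim := (Complex.continuous_re.tendsto _).comp
    (tendsto_mixedDeriv (differentiableAt_fderiv_of_analyticAt (Lv.hF Y)) (Lv.hconv Y 0) (Lv.hconv Y z))
  rw [Lv.ha Y z]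
  exact hlim.congr' ((Lv.term_eq_eventually hα₂ Y z).mono fun n h => h.symm)

/-- **`PolLeavesTFac ⟹ PolLeavesTLoc`**: the torus leaf list with termwise locality of `RemainderLimitTorus`, its field
`hloc` a THEOREM. [cite: Balaban1987RG1, (1.21) p.264] -/
def PolLeavesTFac.toPolLeavesTLoc (hα₂ : 0 < α₂) : PolLeavesTLoc d M a c ℓ α₂ B₃ where
  N := Lv.N
  hN := Lv.hN
  hNlim := Lv.hNlim
  W := Lv.W
  hsp := Lv.hsp
  hrep := Lv.hrep
  h238 := Lv.h238
  Wn := Lv.Wn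
  instW := Lv.instW
  instWs := Lv.instWs
  EXn := Lv.EXn
  emb := Lv.emb
  hemb := Lv.hemb
  hcomp := Lv.hcomp
  hn := Lv.hn
  E2n := Lv.E2n
  han := Lv.han
  hrepr := Lv.hrepr
  hh := Lv.hh
  hloc := Lv.hloc_of_fac hα₂

/-- Hence the (5.1) limit of the SUMS exists and equals `limKernel a` (`RemainderLimitTorus.PolLeavesTLoc.tendsto_sum`),
the infinite-volume terms being `a Y z = Re ∂²(F Y)(t Y 0, t Y z)`. [cite: Balaban1987RG1, (5.1) p.292 and (1.21) p.264] -/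
theorem PolLeavesTFac.tendsto_sum (hC : CondsL d c ℓ) (h22 : c.R22gen ℓ) (hs : SignsL c α₂ B₃) (z : Pt d) :
    Summable (fun Y => a Y z) ∧
      Tendsto (fun n => ∑ X : TDom d (Lv.N n), Lv.E2n n X (proj (Lv.N n * M) 0) (proj (Lv.N n * M) z)) atTop
        (𝓝 (limKernel a z)) :=
  let h := (Lv.toPolLeavesTLoc hs.α₂_pos).tendsto_sum hC h22 hs z
  ⟨h.1, h.2.2⟩

/-- **`PolLeavesTFac ⟹ PolLeavesT`** (`RemainderChainTorus`'s leaf list, its (5.1)-field a theorem) for the DEFINED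
limit kernel `limKernel a`. [cite: Balaban1987RG1, (5.1) p.292] -/
def PolLeavesTFac.toPolLeavesT (hC : CondsL d c ℓ) (h22 : c.R22gen ℓ) (hs : SignsL c α₂ B₃) :
    RemainderChainTorus.PolLeavesT d M (limKernel a) c ℓ α₂ B₃ :=
  (Lv.toPolLeavesTLoc hs.α₂_pos).toPolLeavesT hC h22 hs

end Leaves

/-! ## 3. The chain with (1.7)-factorization and the k-UNIFORM bound — the SAME fully valued coefficient -/

section Chain

variable {M : ℕ} [NeZero M]

/-- **THE REMAINDER CHAIN ON THE PERIODIC CARRIER WITH (1.7)-FACTORIZATION** (the twin of `RemainderLimitTorus.ChainTLoc`):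
`A1 k p` = the infinite-volume localized polarization terms of the (2.13)-half at scale k + 1 and history p; `beta1_eq` =
the dictionary clause (1.22) on the DEFINED limit kernel `limKernel (A1 k p)`; `leaves k p hp` = the torus leaf list with
(F1)/(F2), THE SAME `c, ℓ, α₂, B₃, M` for every k and every history.  A HYPOTHESIS structure.
[cite: Balaban1987RG1, (1.20)-(1.22) p.264 and (1.7) p.261; Balaban1988RG2Cluster, (2.38) p.20] -/
structure ChainTFac (d M : ℕ) [NeZero M] (μ ν : Fin d) {β : HBeta} (S : B12Beta.OneLoopSplit β) (γ : ℝ)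
    (c : B13.Consts) (ℓ α₂ B₃ : ℝ) where
  A1 : (k : ℕ) → (Fin (k + 1) → ℝ) → LDom d → Pt d → ℝ
  beta1_eq : ∀ k p, p ∈ B12Beta.HistBox γ k →
    S.β1 k p = B12Beta.secondMoment (fun _ _ => limKernel (A1 k p)) μ ν
  leaves : ∀ k p, p ∈ B12Beta.HistBox γ k → PolLeavesTFac d M (A1 k p) c ℓ α₂ B₃

variable {μ ν : Fin d} {β : HBeta} {S : B12Beta.OneLoopSplit β} {γ : ℝ} {c : B13.Consts} {ℓ α₂ B₃ : ℝ}

/-- A chain with (1.7)-factorization IS a chain with termwise locality. [folklore] -/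
def ChainTFac.toChainTLoc (R : ChainTFac d M μ ν S γ c ℓ α₂ B₃) (hα₂ : 0 < α₂) : ChainTLoc d M μ ν S γ c ℓ α₂ B₃ where
  A1 := R.A1
  beta1_eq := R.beta1_eq
  leaves := fun k p hp => (R.leaves k p hp).toPolLeavesTLoc hα₂

/-- **THE k-UNIFORM REMAINDER BOUND WITH TERMWISE LOCALITY DERIVED FROM THE PRINTED LOCALITY, coefficient FULLY VALUED AND
IDENTICAL TO `ChainTLoc.abs_beta1_le`'s / `ChainT.abs_beta1_le`'s**: `|β¹_{k+1}(g_0,…,g_k)| ≤ ε₁ · K_rem,L` for EVERY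
scale k and EVERY history in `]0,γ]^{k+1}`.  O(ε₁), not O(g_k), not O(γ²).
[cite: Balaban1988RG2Cluster, (2.38) p.20; Balaban1987RG1, (5.10) p.293, (1.22) p.264 and (1.7) p.261] -/
theorem ChainTFac.abs_beta1_le (R : ChainTFac d M μ ν S γ c ℓ α₂ B₃) (hC : CondsL d c ℓ) (h22 : c.R22gen ℓ)
    (hs : SignsL c α₂ B₃) (hd : 0 < d) : RemainderConst S γ (c.ε₁ * remCoeffL d M c α₂ B₃) :=
  (R.toChainTLoc hs.α₂_pos).abs_beta1_le hC h22 hs hd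

/-- The one-sided form `−ε₁K_rem,L ≤ β¹_{k+1}` on the boxes (RULING (R10)'s remainder slot). [folklore] -/
theorem ChainTFac.neg_le_beta1 (R : ChainTFac d M μ ν S γ c ℓ α₂ B₃) (hC : CondsL d c ℓ) (h22 : c.R22gen ℓ)
    (hs : SignsL c α₂ B₃) (hd : 0 < d) :
    ∀ k (p : Fin (k + 1) → ℝ), p ∈ B12Beta.HistBox γ k → -(c.ε₁ * remCoeffL d M c α₂ B₃) ≤ S.β1 k p :=
  fun k p hp => (abs_le.mp (R.abs_beta1_le hC h22 hs hd k p hp)).1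

/-! ### The RULING (R10) END consumers, by name -/

/-- **`BetaPartialSumsLowerH` from telescoping + the chain with (1.7)-factorization**
(`RemainderLimitTorus.betaPartialSumsLowerH_of_telescope_chainTLoc` ∘ `toChainTLoc`). [cite: Balaban1987RG1, Thm 2 p.259 (first sentence); Balaban1988RG2Cluster, (2.38) p.20] -/
theorem betaPartialSumsLowerH_of_telescope_chainTFac {γ₀ b A : ℝ} {B : ℕ → ℝ} {L : ℕ}
    (R : ChainTFac d M μ ν S γ₀ c ℓ α₂ B₃) (hC : CondsL d c ℓ) (h22 : c.R22gen ℓ) (hs : SignsL c α₂ B₃) (hd : 0 < d)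
    (hL : 2 ≤ L) (hA : 0 ≤ A) (hTel : ∀ k : ℕ, ∑ j ∈ Finset.range k, S.β0 j = B (L ^ k))
    (hB : ∀ n : ℕ, 2 ≤ n → |B n - b * Real.log n| ≤ A) (hε₁ : c.ε₁ * remCoeffL d M c α₂ B₃ ≤ b * Real.log L) :
    BetaPartialSumsLowerH (2 * A) γ₀ β :=
  betaPartialSumsLowerH_of_telescope_chainTLoc (R.toChainTLoc hs.α₂_pos) hC h22 hs hd hL hA hTel hB hε₁

/-- **ENDPOINT EXISTENCE from telescoping + the chain with (1.7)-factorization**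
(`RemainderLimitTorus.endpointExistence_of_telescope_chainTLoc` ∘ `toChainTLoc`). [cite: Balaban1987RG1, Thm 2 p.259 (first sentence); Balaban1988RG2Cluster, (2.38) p.20] -/
theorem endpointExistence_of_telescope_chainTFac {C : B12.Construction} (hgen : ForwardGenerated C β)
    {γ₀ b A β' : ℝ} {B : ℕ → ℝ} {L : ℕ} (R : ChainTFac d M μ ν S γ₀ c ℓ α₂ B₃) (hC : CondsL d c ℓ)
    (h22 : c.R22gen ℓ) (hs : SignsL c α₂ B₃) (hd : 0 < d) (hγ₀ : 0 < γ₀) (hL : 2 ≤ L) (hA : 0 ≤ A)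
    (hTel : ∀ k : ℕ, ∑ j ∈ Finset.range k, S.β0 j = B (L ^ k))
    (hB : ∀ n : ℕ, 2 ≤ n → |B n - b * Real.log n| ≤ A)
    (hε₁ : c.ε₁ * remCoeffL d M c α₂ B₃ ≤ b * Real.log L) (hβ' : 0 ≤ β') (hcont : BetaContH γ₀ β)
    (hup : BetaUpperH β' γ₀ β) : EndpointExistence C :=
  endpointExistence_of_telescope_chainTLoc hgen (R.toChainTLoc hs.α₂_pos) hC h22 hs hd hγ₀ hL hA hTel hB hε₁ hβ'
    hcont hup

end Chain

end

end Literature.MathematicalPhysics.QuantumFieldTheory.Balaban1983to89.Beta.RemainderLocality
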